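import Summits.BirchSwinnertonDyer.Rank1Residual.Additive.GordDescentModelFreeCases
import Literature.NumberTheory.EllipticCurves.Wuthrich2014.ThreeAdicImageSupersingularProofs
import HarnessLib

/-!
# `GordDescentModelFreeCases` WITHOUT the binder `hL20` (Wuthrich's Lemma 20 is a tree theorem): binder-free twins

HONEST FRAMING (cell `b2b-bsdres`, run/shared/lean/b2b/bsd-rank1-residual/, verbatim in every
file): the goal of the cell is to DELETE the COMBINATION-SHAPED residual classes of the
Birch–Swinnerton-Dyer formula for ALL analytic-rank `≤ 1` elliptic curves over `ℚ` — "full BSD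
formula for every rank `≤ 1` curve in class `C`" assembled STRICTLY from published theorems — so
that the rank-`≤ 1` remainder becomes exactly the CONSTRUCTION-SHAPED classes, which are TYPED
(missing-input `Prop`s), NOT attempted. This is not "finishing BSD". Team n1011 (N10 / N11), seat
p05, OWNERS row T-b1ss = the `hL20`-BINDER SWEEP on `Additive/` + `AdditivePotMult/`: Wuthrich's
Lemma 20 (registry A9, the named fact `Wuthrich2014.lemma20_surjective_threeAdic_of_semistable`: at a
prime-to-`9` conductor, `ρ̄_{E,3}` onto ⟹ `ρ̄_{E,3ⁿ}` onto for all `n`) is a tree THEOREM since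
2026-08-21 (`Wuthrich2014.lemma20_surjective_threeAdic_of_semistable_holds`, file
`Literature/NumberTheory/EllipticCurves/Wuthrich2014/ThreeAdicImageSupersingularProofs.lean`, units
lit-kato / n1011-p02), so every theorem of the cell carrying it as a hypothesis has a twin WITHOUT that
binder.  This file states those twins for the theorems of its sibling (suffix `_noL20`; statement =
the sibling's statement with the binder deleted, other hypotheses unchanged; proof = the sibling's
theorem fed with `_holds`).  No claim beyond the stated classes; labels UNCHANGED; nothing is booked.
Theorems only (no definition, no named fact minted).

## What this file proves

Binder-free twins (`_noL20`) of the 3 theorems of `Summits/BirchSwinnertonDyer/Rank1Residual/Additive/GordDescentModelFreeCases.lean` that carry the hypothesis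
`(hL20 : Wuthrich2014.lemma20_surjective_threeAdic_of_semistable)`:
* `bsdp_of_classX4Gord_two_cases_noL20`
* `bsdp_of_classX3Gord_two_cases_noL20`
* `bsdp_of_classX3_of_subGordTwo_cases_noL20`

References: [Wuthrich2014] C. Wuthrich, Doc. Math. 19 (2014) 381–402, Lemma 20 (p. 399); the
sibling's references for everything else.
-/

noncomputable section

open scoped Classical NumberField

open WeierstrassCurve IsDedekindDomain NumberField Literature.NumberTheory.EllipticCurves
  Literature.NumberTheory.EllipticCurves.Rank1Residual
  Literature.NumberTheory.EllipticCurves.Rank1Residual.Typed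
  Literature.NumberTheory.EllipticCurves.ModularForms
  Literature.NumberTheory.EllipticCurves.Wuthrich2014
  Summit.BirchSwinnertonDyer.Rank1Residual.AdditivePotMult

namespace Summit.BirchSwinnertonDyer.Rank1Residual.Additive

variable (W : WeierstrassCurve ℚ) [W.IsElliptic] [W.IsGloballyMinimal] (p : ℕ) [hp : Fact p.Prime]

section X4

/-- **Binder-free twin of `bsdp_of_classX4Gord_two_cases`** — the same statement WITHOUT the hypothesis
`Wuthrich2014.lemma20_surjective_threeAdic_of_semistable` (Wuthrich 2014 Lemma 20 = registry A9, now the tree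
theorem `…_holds`); proof = the original fed with `_holds`. [cite: Wuthrich2014, Lemma 20 (p. 399)] -/
theorem bsdp_of_classX4Gord_two_cases_noL20
    (hSk : Skinner2016.thmC_padicValRat_bsd_rank_zero)
    (hBCS : BurungaleCastellaSkinner2025.cor131_padicValRat_bsd_rank_le_one)
    (hJSW : JetchevSkinnerWan2017.thm121_padicValRat_bsd_rank_one)
    (hCGS : CastellaGrossiSkinner2025.thmD_padicValRat_bsd_rank_le_one)
    (hGV : GreenbergVatsal2000.thm13_charIdeal_eq_of_gvPar) (hGr : greenberg_charValue_rankZero)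
    (hmod : hasEntireLFunction_rat) (hmodP : nonempty_modularParametrizationData)
    (hGZK : rank_eq_analyticRank_of_analyticRank_le_one) (hCM : bsdTriple_of_hasCM_of_L_one_ne_zero)
    (hKob : Kobayashi2013.cor14_bsdp_of_cm_rank_one)
    (hYZ : YanZhu2026.thm415_padicValRat_bsd_rank_le_one)
    (hLLT : LiLiuTian2024.thm11_bsdp_of_cm_rank_one)
    (hMilneC : Milne1972.bsdQuotient_baseChange_quadratic_anyModel) (hp5 : 5 ≤ p)
    (hX : ClassX4Gord W p) (he : semistabilityIndex W p = 2) (hr : W.analyticRank ≤ 1)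
    (hrd : (W.quadraticTwist ((-1 : ℚ) ^ (p / 2) * p)).analyticRank ≤ 1)
    (hK : ∀ (K : Type) [Field K] [NumberField K], Module.finrank ℚ K = 2 →
      (NumberField.discr K : ℚ) = (-1 : ℚ) ^ (p / 2) * p → MissingPPartOverCAt (W.baseChange K) p)
    (hX9 : ∀ (Wd : WeierstrassCurve ℚ) [Wd.IsElliptic] [Wd.IsGloballyMinimal],
      (∃ C : VariableChange ℚ, C • W.quadraticTwist ((-1 : ℚ) ^ (p / 2) * p) = Wd) →
      ClassX9 Wd p → X9.MissingInputAt Wd p)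
    (hX10 : ∀ (Wd : WeierstrassCurve ℚ) [Wd.IsElliptic] [Wd.IsGloballyMinimal],
      (∃ C : VariableChange ℚ, C • W.quadraticTwist ((-1 : ℚ) ^ (p / 2) * p) = Wd) →
      ClassX10 Wd p → X10.MissingInputAt Wd) :
    BSDp W p :=
  bsdp_of_classX4Gord_two_cases W p hSk hBCS hJSW hCGS hGV hGr hmod hmodP hGZK hCM hKob hYZ
    Wuthrich2014.lemma20_surjective_threeAdic_of_semistable_holds hLLT hMilneC hp5 hX he hr hrd hK
    hX9 hX10

end X4

section X3

/-- **Binder-free twin of `bsdp_of_classX3Gord_two_cases`** — the same statement WITHOUT the hypothesis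
`Wuthrich2014.lemma20_surjective_threeAdic_of_semistable` (Wuthrich 2014 Lemma 20 = registry A9, now the tree
theorem `…_holds`); proof = the original fed with `_holds`. [cite: Wuthrich2014, Lemma 20 (p. 399)] -/
theorem bsdp_of_classX3Gord_two_cases_noL20
    (hSk : Skinner2016.thmC_padicValRat_bsd_rank_zero)
    (hBCS : BurungaleCastellaSkinner2025.cor131_padicValRat_bsd_rank_le_one)
    (hJSW : JetchevSkinnerWan2017.thm121_padicValRat_bsd_rank_one)
    (hCGS : CastellaGrossiSkinner2025.thmD_padicValRat_bsd_rank_le_one)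
    (hGV : GreenbergVatsal2000.thm13_charIdeal_eq_of_gvPar) (hGr : greenberg_charValue_rankZero)
    (hmod : hasEntireLFunction_rat) (hmodP : nonempty_modularParametrizationData)
    (hGZK : rank_eq_analyticRank_of_analyticRank_le_one) (hCM : bsdTriple_of_hasCM_of_L_one_ne_zero)
    (hKob : Kobayashi2013.cor14_bsdp_of_cm_rank_one)
    (hYZ : YanZhu2026.thm415_padicValRat_bsd_rank_le_one)
    (hLLT : LiLiuTian2024.thm11_bsdp_of_cm_rank_one) (hW : sha_dvd_analyticSha)
    (hMilneC : Milne1972.bsdQuotient_baseChange_quadratic_anyModel) (hp5 : 5 ≤ p)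
    (hX : ClassX3Gord W p) (he : semistabilityIndex W p = 2) (hr : W.analyticRank ≤ 1)
    (hrd : (W.quadraticTwist ((-1 : ℚ) ^ (p / 2) * p)).analyticRank ≤ 1)
    (hK : ∀ (K : Type) [Field K] [NumberField K], Module.finrank ℚ K = 2 →
      (NumberField.discr K : ℚ) = (-1 : ℚ) ^ (p / 2) * p → MissingPPartOverCAt (W.baseChange K) p)
    (hX1 : ∀ (Wd : WeierstrassCurve ℚ) [Wd.IsElliptic] [Wd.IsGloballyMinimal],
      (∃ C : VariableChange ℚ, C • W.quadraticTwist ((-1 : ℚ) ^ (p / 2) * p) = Wd) →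
      ClassX1 Wd p → X1.MissingInputAt Wd p) :
    BSDp W p :=
  bsdp_of_classX3Gord_two_cases W p hSk hBCS hJSW hCGS hGV hGr hmod hmodP hGZK hCM hKob hYZ
    Wuthrich2014.lemma20_surjective_threeAdic_of_semistable_holds hLLT hW hMilneC hp5 hX he hr hrd
    hK hX1

/-- **Binder-free twin of `bsdp_of_classX3_of_subGordTwo_cases`** — the same statement WITHOUT the hypothesis
`Wuthrich2014.lemma20_surjective_threeAdic_of_semistable` (Wuthrich 2014 Lemma 20 = registry A9, now the tree
theorem `…_holds`); proof = the original fed with `_holds`. [cite: Wuthrich2014, Lemma 20 (p. 399)] -/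
theorem bsdp_of_classX3_of_subGordTwo_cases_noL20
    (hSk : Skinner2016.thmC_padicValRat_bsd_rank_zero)
    (hBCS : BurungaleCastellaSkinner2025.cor131_padicValRat_bsd_rank_le_one)
    (hJSW : JetchevSkinnerWan2017.thm121_padicValRat_bsd_rank_one)
    (hCGS : CastellaGrossiSkinner2025.thmD_padicValRat_bsd_rank_le_one)
    (hGV : GreenbergVatsal2000.thm13_charIdeal_eq_of_gvPar) (hGr : greenberg_charValue_rankZero)
    (hmod : hasEntireLFunction_rat) (hmodP : nonempty_modularParametrizationData)
    (hGZK : rank_eq_analyticRank_of_analyticRank_le_one) (hCM : bsdTriple_of_hasCM_of_L_one_ne_zero)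
    (hKob : Kobayashi2013.cor14_bsdp_of_cm_rank_one)
    (hYZ : YanZhu2026.thm415_padicValRat_bsd_rank_le_one)
    (hLLT : LiLiuTian2024.thm11_bsdp_of_cm_rank_one) (hW : sha_dvd_analyticSha)
    (hMilneC : Milne1972.bsdQuotient_baseChange_quadratic_anyModel) (hp5 : 5 ≤ p) (hX : ClassX3 W p)
    (hS : SubGordTwo W p) (hr : W.analyticRank ≤ 1)
    (hrd : (W.quadraticTwist ((-1 : ℚ) ^ (p / 2) * p)).analyticRank ≤ 1)
    (hK : ∀ (K : Type) [Field K] [NumberField K], Module.finrank ℚ K = 2 →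
      (NumberField.discr K : ℚ) = (-1 : ℚ) ^ (p / 2) * p → MissingPPartOverCAt (W.baseChange K) p)
    (hX1 : ∀ (Wd : WeierstrassCurve ℚ) [Wd.IsElliptic] [Wd.IsGloballyMinimal],
      (∃ C : VariableChange ℚ, C • W.quadraticTwist ((-1 : ℚ) ^ (p / 2) * p) = Wd) →
      ClassX1 Wd p → X1.MissingInputAt Wd p) :
    BSDp W p :=
  bsdp_of_classX3_of_subGordTwo_cases W p hSk hBCS hJSW hCGS hGV hGr hmod hmodP hGZK hCM hKob hYZ
    Wuthrich2014.lemma20_surjective_threeAdic_of_semistable_holds hLLT hW hMilneC hp5 hX hS hr hrd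
    hK hX1

end X3

section OneSided

end OneSided

end Summit.BirchSwinnertonDyer.Rank1Residual.Additive

end
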